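import Literature.AlgebraicGeometry.HodgeTheory.LimitMixedHodgeStructureSl2TripleNaturality
import HarnessLib

/-!
# Deligne's `δ` along a nilpotent orbit: `δ(W, e^{zN}F) = δ(W, F) + (Im z) N`

For a mixed Hodge structure `(W, F)` with Deligne's real `δ ∈ Λ^{-1,-1}` (Cattani–Kaplan–Schmid (2.20), Kato–Usui
§6.1.2: the UNIQUE real `δ ∈ L^{-1,-1}_ℝ` with `(W, e^{-iδ}F)` split over `ℝ`), the uniqueness immediately controls
how `δ` and the `δ`-splitting `F̂ = e^{-iδ}F` move under the two basic changes of `F` inside `exp Λ^{-1,-1}`: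

* §1 (real unipotent twists — the `δ`-analogue of Kato–Usui §6.1.1 (7), `(Ad(g)N, gF) ↦ (Int(g)ρ, gφ)`): for a
  REAL `X ∈ Λ^{-1,-1}` (`X̄ = X`), `isSplitOverR_lambdaTwist_iff_of_endConj_eq` (`(W, e^X F)` is `ℝ`-split iff
  `(W, F)` is), **`delta_lambdaTwist_of_endConj_eq : δ(W, e^X F) = e^X δ e^{-X}`** and
  `deltaSplit_lambdaTwist_of_endConj_eq : (W, e^X F)^ = (W, e^X F̂)`;
* §2 (purely imaginary commuting twists — the `δ`-analogue of Kato–Usui §6.1.1 (6), "`(N, exp(iyN)F)` has the same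
  associated `SL(2)`-orbit"): for a real `S ∈ Λ^{-1,-1}` commuting with `δ`,
  **`delta_lambdaTwist_I_smul : δ(W, e^{iS} F) = δ(W, F) + S`** and `deltaSplit_lambdaTwist_I_smul : (W, e^{iS}F)^ = F̂`;
* §3 for a limit mixed Hodge structure `(W, F, N)` and the change of coordinate `F ↦ e^{zN}F` (Cattani et al. (7.5.8);
  `[N, δ] = 0` as `N` is a `(-1,-1)`-morphism, Kato–Usui (9)): **`delta_expTwist : δ(W, e^{zN}F) = δ + (Im z) N_ℂ`**,
  **`deltaSplit_expTwist : (W, e^{zN}F, N)^ = (W, e^{(Re z)N}F̂, N)`** — the `δ`-splitting is CONSTANT along the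
  imaginary direction of the nilpotent orbit (`deltaSplit_expTwist_of_re_eq_zero`) — and
  `isSplitOverR_expTwist_iff` (`e^{zN}F` is `ℝ`-split iff `δ + (Im z)N = 0`; for `ℝ`-split `F` and `N ≠ 0` iff `z ∈ ℝ`).

Everything is proved (by the uniqueness `eq_delta_of_isSplitOverR` of `MixedHodgeStructureDeligneDelta.lean`); no named
fact, no definition, no instance.

## References

* [KatoUsui2009] K. Kato, S. Usui, Ann. of Math. Stud. 169 (2009), §6.1.1 (6), (7); §6.1.2 (definition of `δ`, (9), (10)).
* [CattaniKaplanSchmid1986] E. Cattani, A. Kaplan, W. Schmid, Ann. of Math. 123 (1986), Prop. (2.20).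
* [KerrPearlstein2011] M. Kerr, G. Pearlstein, MSRI Publ. 58 (2011), §4.2 Thm. 68, (4-5), Remark 69.
* [CattaniElZeinGriffithsLe2014] E. Cattani et al. (eds.), *Hodge Theory* (2014), §7.5 (7.5.8).
-/

noncomputable section

open scoped TensorProduct

universe u

namespace Literature.AlgebraicGeometry.Motives.MixedHodgeStructure

open HodgeStructure (conj complexConj endConj endConj_apply map_endConj_complexConj endConj_exp)

variable {V : Type u} [AddCommGroup V] [Module ℚ V]

/-! ## §0 Conjugating a nilpotent exponential -/

/-- `e^X e^{T} e^{-X} = e^{e^X T e^{-X}}` for nilpotent `X`, `T` (conjugation by `e^X` is a ring homomorphism).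
[folklore] -/
private theorem exp_mul_exp_mul_exp_neg {X T : Module.End ℂ (ℂ ⊗[ℚ] V)} (hX : IsNilpotent X) (hT : IsNilpotent T) :
    IsNilpotent.exp X * IsNilpotent.exp T * IsNilpotent.exp (-X) =
      IsNilpotent.exp (IsNilpotent.exp X * T * IsNilpotent.exp (-X)) := by
  have huv := IsNilpotent.exp_mul_exp_neg_self hX
  have hvu := IsNilpotent.exp_neg_mul_exp_self hX
  let f : Module.End ℂ (ℂ ⊗[ℚ] V) →+* Module.End ℂ (ℂ ⊗[ℚ] V) :=
    { toFun := fun S => IsNilpotent.exp X * S * IsNilpotent.exp (-X)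
      map_one' := by rw [mul_one, huv]
      map_mul' := fun S S' => by
        simp only [mul_assoc]
        rw [← mul_assoc (IsNilpotent.exp (-X)) (IsNilpotent.exp X), hvu, one_mul]
      map_zero' := by rw [mul_zero, zero_mul]
      map_add' := fun S S' => by rw [mul_add, add_mul] }
  have h := IsNilpotent.map_exp (B := Module.End ℂ (ℂ ⊗[ℚ] V)) hT f
  simpa only [f, RingHom.coe_mk, MonoidHom.coe_mk, OneHom.coe_mk] using h

/-- `e^X` is injective for nilpotent `X`. [folklore] -/
private theorem exp_injective {X : Module.End ℂ (ℂ ⊗[ℚ] V)} (hX : IsNilpotent X) :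
    Function.Injective (IsNilpotent.exp X : Module.End ℂ (ℂ ⊗[ℚ] V)) := by
  refine Function.LeftInverse.injective (g := fun v => IsNilpotent.exp (-X) v) fun v => ?_
  show IsNilpotent.exp (-X) (IsNilpotent.exp X v) = v
  rw [← Module.End.mul_apply, IsNilpotent.exp_neg_mul_exp_self hX, Module.End.one_apply]

variable [FiniteDimensional ℚ V] (H : MixedHodgeStructure V)

/-! ## §1 Real unipotent twists `F ↦ e^X F`, `X ∈ Λ^{-1,-1}_ℝ` -/

section RealTwist

variable {H} {X : Module.End ℂ (ℂ ⊗[ℚ] V)} (hX : X ∈ H.lambda) (hreal : endConj X = X)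

omit [FiniteDimensional ℚ V] in
include hreal in
/-- A real nilpotent `X` has a real exponential: `\overline{e^X} = e^X`. [cite: KatoUsui2009, §6.1.2 (L_ℝ^{-1,-1})] -/
theorem endConj_exp_of_endConj_eq (hXn : IsNilpotent X) : endConj (IsNilpotent.exp X) = IsNilpotent.exp X := by
  rw [endConj_exp hXn, hreal]

omit [FiniteDimensional ℚ V] in
include hX hreal in
/-- **`(W, e^X F)` is split over `ℝ` iff `(W, F)` is**, for a real `X ∈ Λ^{-1,-1}` (`I^{p,q}(e^X F) = e^X I^{p,q}(F)`,
Kerr–Pearlstein (4-5), and `e^X` commutes with complex conjugation). [cite: KerrPearlstein2011, §4.2 (4-5)]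
[cite: KatoUsui2009, §6.1.1 (7) and §6.1.2 (10)] -/
theorem isSplitOverR_lambdaTwist_iff_of_endConj_eq : (H.lambdaTwist hX).IsSplitOverR ↔ H.IsSplitOverR := by
  have hXn := H.isNilpotent_of_mem_lambda hX
  have hinj : Function.Injective (Submodule.map (IsNilpotent.exp X) : Submodule ℂ (ℂ ⊗[ℚ] V) → _) :=
    Submodule.map_injective_of_injective (exp_injective hXn)
  refine forall_congr' fun p => forall_congr' fun q => ?_
  rw [H.deligneI_lambdaTwist hX, H.deligneI_lambdaTwist hX, ← map_endConj_complexConj,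
    endConj_exp_of_endConj_eq hreal hXn]
  exact hinj.eq_iff

include hX in
/-- The key identity of maps: `e^{-i e^X δ e^{-X}} e^X = e^X e^{-iδ}`. [cite: CattaniKaplanSchmid1986, Prop. (2.20)] -/
theorem exp_neg_I_smul_conj_delta_mul_exp :
    IsNilpotent.exp (-Complex.I • (IsNilpotent.exp X * H.delta * IsNilpotent.exp (-X))) * IsNilpotent.exp X =
      IsNilpotent.exp X * IsNilpotent.exp (-Complex.I • H.delta) := by
  have hXn := H.isNilpotent_of_mem_lambda hX
  have h1 : -Complex.I • (IsNilpotent.exp X * H.delta * IsNilpotent.exp (-X)) =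
      IsNilpotent.exp X * (-Complex.I • H.delta) * IsNilpotent.exp (-X) := by
    rw [mul_smul_comm, smul_mul_assoc]
  rw [h1, ← exp_mul_exp_mul_exp_neg hXn (H.isNilpotent_delta.smul _), mul_assoc,
    IsNilpotent.exp_neg_mul_exp_self hXn, mul_one]

include hX in
/-- On Hodge filtrations: `e^{-i e^X δ e^{-X}} (e^X F^p) = e^X (e^{-iδ} F^p)`. [cite: CattaniKaplanSchmid1986, Prop. (2.20)] -/
theorem map_exp_neg_I_smul_conj_delta_map_exp (p : ℤ) :
    ((H.F p).map (IsNilpotent.exp X)).map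
        (IsNilpotent.exp (-Complex.I • (IsNilpotent.exp X * H.delta * IsNilpotent.exp (-X)))) =
      ((H.F p).map (IsNilpotent.exp (-Complex.I • H.delta))).map (IsNilpotent.exp X) := by
  rw [← Submodule.map_comp, ← Submodule.map_comp, ← Module.End.mul_eq_comp, ← Module.End.mul_eq_comp,
    H.exp_neg_I_smul_conj_delta_mul_exp hX]

include hX in
/-- `X ∈ Λ^{-1,-1}_{(F̂, W)}` (`= Λ^{-1,-1}_{(F,W)}`, Kerr–Pearlstein Remark 69). [cite: KerrPearlstein2011, Remark 69] -/
theorem mem_lambda_deltaSplit_of_mem_lambda : X ∈ H.deltaSplit.lambda := by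
  rw [lambda_deltaSplit]; exact hX

include hX in
/-- `e^X δ e^{-X} ∈ Λ^{-1,-1}_{(e^X F, W)}`. [cite: KerrPearlstein2011, Remark 69] -/
theorem conj_delta_mem_lambda_lambdaTwist :
    IsNilpotent.exp X * H.delta * IsNilpotent.exp (-X) ∈ (H.lambdaTwist hX).lambda := by
  rw [lambda_lambdaTwist]
  exact H.exp_mul_mul_exp_neg_mem_lambda H.delta_mem_lambda hX

include hX in
/-- The structures `(W, e^{-i e^Xδe^{-X}} e^X F)` and `(W, e^X F̂)` coincide. [cite: CattaniKaplanSchmid1986, Prop. (2.20)] -/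
theorem lambdaTwist_lambdaTwist_neg_I_smul_conj_delta
    (h₁ : -Complex.I • (IsNilpotent.exp X * H.delta * IsNilpotent.exp (-X)) ∈ (H.lambdaTwist hX).lambda)
    (h₂ : X ∈ H.deltaSplit.lambda) :
    (H.lambdaTwist hX).lambdaTwist h₁ = H.deltaSplit.lambdaTwist h₂ := by
  refine ext_of_W_F (by rw [lambdaTwist_W, lambdaTwist_W, lambdaTwist_W, deltaSplit_W]) (funext fun p => ?_)
  rw [lambdaTwist_F, lambdaTwist_F, lambdaTwist_F, deltaSplit_F]
  exact H.map_exp_neg_I_smul_conj_delta_map_exp hX p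

include hreal in
/-- **`δ(W, e^X F) = e^X δ(W, F) e^{-X}` for a real `X ∈ Λ^{-1,-1}`** — the `δ`-analogue of Kato–Usui §6.1.1 (7)
(`(Ad(g)N, gF) ↦ (Int(g)ρ, gφ)` for `g ∈ G_ℝ`), by uniqueness: `Ad(e^X)δ` is real, lies in
`Λ^{-1,-1}_{(e^X F, W)} = Λ^{-1,-1}_{(F,W)}`, and `(W, e^{-i Ad(e^X)δ} e^X F) = (W, e^X F̂)` is split over `ℝ`.
[cite: KatoUsui2009, §6.1.1 (7) and §6.1.2 (uniqueness of δ)] [cite: CattaniKaplanSchmid1986, Prop. (2.20)] -/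
theorem delta_lambdaTwist_of_endConj_eq :
    (H.lambdaTwist hX).delta = IsNilpotent.exp X * H.delta * IsNilpotent.exp (-X) := by
  have hXn := H.isNilpotent_of_mem_lambda hX
  symm
  refine (H.lambdaTwist hX).eq_delta_of_isSplitOverR ?_ (H.conj_delta_mem_lambda_lambdaTwist hX) ?_
  · rw [map_mul, map_mul, endConj_exp_of_endConj_eq hreal hXn, endConj_delta, endConj_exp hXn.neg, map_neg, hreal]
  · rw [H.lambdaTwist_lambdaTwist_neg_I_smul_conj_delta hX _ (H.mem_lambda_deltaSplit_of_mem_lambda hX)]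
    exact (isSplitOverR_lambdaTwist_iff_of_endConj_eq (H.mem_lambda_deltaSplit_of_mem_lambda hX) hreal).2
      H.isSplitOverR_deltaSplit

include hreal in
/-- **The `δ`-splitting commutes with real unipotent twists: `(W, e^X F)^ = (W, e^X F̂)`** (`X ∈ Λ^{-1,-1}` real).
[cite: KatoUsui2009, §6.1.1 (7)] [cite: CattaniKaplanSchmid1986, Prop. (2.20)] -/
theorem deltaSplit_lambdaTwist_of_endConj_eq (h₂ : X ∈ H.deltaSplit.lambda) :
    (H.lambdaTwist hX).deltaSplit = H.deltaSplit.lambdaTwist h₂ := by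
  refine ext_of_W_F (by rw [deltaSplit_W, lambdaTwist_W, lambdaTwist_W, deltaSplit_W]) (funext fun p => ?_)
  rw [deltaSplit_F, lambdaTwist_F, lambdaTwist_F, deltaSplit_F, H.delta_lambdaTwist_of_endConj_eq hX hreal]
  exact H.map_exp_neg_I_smul_conj_delta_map_exp hX p

end RealTwist

/-! ## §2 Purely imaginary twists `F ↦ e^{iS} F` by a real `S ∈ Λ^{-1,-1}` commuting with `δ` -/

section ImaginaryTwist

variable {H} {S : Module.End ℂ (ℂ ⊗[ℚ] V)} (hS : S ∈ H.lambda) (hreal : endConj S = S) (hc : Commute S H.delta)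

omit [FiniteDimensional ℚ V] in
include hS in
/-- `iS ∈ Λ^{-1,-1}`. [cite: KatoUsui2009, §6.1.2] -/
theorem I_smul_mem_lambda : Complex.I • S ∈ H.lambda := H.lambda.smul_mem _ hS

include hS hc in
/-- The key identity of maps: `e^{-i(δ + S)} e^{iS} = e^{-iδ}` (`[S, δ] = 0`). [cite: CattaniKaplanSchmid1986, Prop. (2.20)] -/
theorem exp_neg_I_smul_delta_add_mul_exp_I_smul :
    IsNilpotent.exp (-Complex.I • (H.delta + S)) * IsNilpotent.exp (Complex.I • S) =
      IsNilpotent.exp (-Complex.I • H.delta) := by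
  have hSn := H.isNilpotent_of_mem_lambda hS
  have hsum : -Complex.I • (H.delta + S) + Complex.I • S = -Complex.I • H.delta := by
    rw [smul_add, neg_smul, neg_smul, add_assoc, neg_add_cancel, add_zero]
  have hcomm : Commute (-Complex.I • (H.delta + S)) (Complex.I • S) :=
    ((hc.symm.add_left (Commute.refl S)).smul_left _).smul_right _
  rw [← IsNilpotent.exp_add_of_commute hcomm ((H.lambda.add_mem H.delta_mem_lambda hS |>
    H.isNilpotent_of_mem_lambda).smul _) (hSn.smul _), hsum]

include hS hc in
/-- On Hodge filtrations: `e^{-i(δ+S)} (e^{iS} F^p) = e^{-iδ} F^p`. [cite: CattaniKaplanSchmid1986, Prop. (2.20)] -/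
theorem map_exp_neg_I_smul_delta_add_map_exp_I_smul (p : ℤ) :
    ((H.F p).map (IsNilpotent.exp (Complex.I • S))).map (IsNilpotent.exp (-Complex.I • (H.delta + S))) =
      (H.F p).map (IsNilpotent.exp (-Complex.I • H.delta)) := by
  rw [← Submodule.map_comp, ← Module.End.mul_eq_comp, H.exp_neg_I_smul_delta_add_mul_exp_I_smul hS hc]

include hS hc in
/-- The structures `(W, e^{-i(δ+S)} e^{iS} F)` and `(W, F̂)` coincide. [cite: CattaniKaplanSchmid1986, Prop. (2.20)] -/
theorem lambdaTwist_lambdaTwist_neg_I_smul_delta_add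
    (h₁ : -Complex.I • (H.delta + S) ∈ (H.lambdaTwist (H.I_smul_mem_lambda hS)).lambda) :
    (H.lambdaTwist (H.I_smul_mem_lambda hS)).lambdaTwist h₁ = H.deltaSplit := by
  refine ext_of_W_F (by rw [lambdaTwist_W, lambdaTwist_W, deltaSplit_W]) (funext fun p => ?_)
  rw [lambdaTwist_F, lambdaTwist_F, deltaSplit_F]
  exact H.map_exp_neg_I_smul_delta_add_map_exp_I_smul hS hc p

include hreal hc in
/-- **`δ(W, e^{iS} F) = δ(W, F) + S` for a real `S ∈ Λ^{-1,-1}` commuting with `δ`** — the `δ`-analogue of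
Kato–Usui §6.1.1 (6) (`S = yN`), by uniqueness: `δ + S` is real, in `Λ^{-1,-1}`, and
`(W, e^{-i(δ+S)} e^{iS} F) = (W, e^{-iδ}F)` is split over `ℝ`. [cite: KatoUsui2009, §6.1.1 (6) and §6.1.2 (uniqueness of δ)]
[cite: CattaniKaplanSchmid1986, Prop. (2.20)] -/
theorem delta_lambdaTwist_I_smul : (H.lambdaTwist (H.I_smul_mem_lambda hS)).delta = H.delta + S := by
  symm
  refine (H.lambdaTwist (H.I_smul_mem_lambda hS)).eq_delta_of_isSplitOverR ?_ ?_ ?_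
  · rw [map_add, endConj_delta, hreal]
  · rw [lambda_lambdaTwist]
    exact H.lambda.add_mem H.delta_mem_lambda hS
  · rw [H.lambdaTwist_lambdaTwist_neg_I_smul_delta_add hS hc]
    exact H.isSplitOverR_deltaSplit

include hreal hc in
/-- **Purely imaginary commuting twists do not change the `δ`-splitting: `(W, e^{iS}F)^ = (W, F)^`.**
[cite: KatoUsui2009, §6.1.1 (6)] [cite: CattaniKaplanSchmid1986, Prop. (2.20)] -/
theorem deltaSplit_lambdaTwist_I_smul : (H.lambdaTwist (H.I_smul_mem_lambda hS)).deltaSplit = H.deltaSplit := by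
  refine ext_of_W_F (by rw [deltaSplit_W, lambdaTwist_W, deltaSplit_W]) (funext fun p => ?_)
  rw [deltaSplit_F, lambdaTwist_F, deltaSplit_F, H.delta_lambdaTwist_I_smul hS hreal hc]
  exact H.map_exp_neg_I_smul_delta_add_map_exp_I_smul hS hc p

include hS hreal hc in
/-- `(W, e^{iS}F)` is split over `ℝ` iff `δ + S = 0`. [cite: KatoUsui2009, §6.1.2 (10)] [cite: CattaniKaplanSchmid1986, Prop. (2.20)] -/
theorem isSplitOverR_lambdaTwist_I_smul_iff : (H.lambdaTwist (H.I_smul_mem_lambda hS)).IsSplitOverR ↔ H.delta + S = 0 := by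
  rw [← delta_eq_zero_iff, H.delta_lambdaTwist_I_smul hS hreal hc]

end ImaginaryTwist

end Literature.AlgebraicGeometry.Motives.MixedHodgeStructure

namespace Literature.AlgebraicGeometry.HodgeTheory

open Motives Motives.MixedHodgeStructure
open Motives.HodgeStructure (endConj endConj_baseChange endConj_smul)

variable {V : Type u} [AddCommGroup V] [Module ℚ V] [FiniteDimensional ℚ V] {k : ℤ}

namespace LimitMixedHodgeStructure

/-! ## §3 The change of coordinate `F ↦ e^{zN}F` of a limit mixed Hodge structure -/

variable (L : LimitMixedHodgeStructure V k)

omit [FiniteDimensional ℚ V] in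
/-- Two limit MHS with the same underlying MHS and the same `N` are equal. [cite: CattaniElZeinGriffithsLe2014, Def. 7.5.9] -/
private theorem ext_of_toMixedHodgeStructure_N' {L L' : LimitMixedHodgeStructure V k}
    (h : L.toMixedHodgeStructure = L'.toMixedHodgeStructure) (hN : L.N = L'.N) : L = L' := by
  obtain ⟨M, N, _, _, _⟩ := L
  obtain ⟨M', N', _, _, _⟩ := L'
  simp only at h hN
  subst h hN
  rfl

omit [FiniteDimensional ℚ V] in
/-- `x N_ℂ` is real for real `x`: `\overline{x N_ℂ} = x N_ℂ`. [cite: CattaniElZeinGriffithsLe2014, Def. 7.5.9] -/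
theorem endConj_ofReal_smul_N_baseChange (x : ℝ) :
    endConj ((x : ℂ) • L.N.baseChange ℂ) = (x : ℂ) • L.N.baseChange ℂ := by
  rw [endConj_smul, endConj_baseChange, Complex.conj_ofReal]

omit [FiniteDimensional ℚ V] in
/-- The coordinate change splits as an imaginary twist followed by a real one:
`(W, e^{zN}F) = (W, e^{(Re z)N} (e^{i(Im z)N} F))`. [cite: CattaniElZeinGriffithsLe2014, §7.5 (7.5.7)–(7.5.8)] -/
theorem expTwist_eq_expTwist_expTwist (z : ℂ) :
    L.expTwist z = (L.expTwist ((z.im : ℂ) * Complex.I)).expTwist (z.re : ℂ) := by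
  refine ext_of_toMixedHodgeStructure_N' (ext_of_W_F (by rw [expTwist_W, expTwist_W, expTwist_W])
    (funext fun p => ?_)) rfl
  exact ((L.expTwist_expTwist_F (z.re : ℂ) ((z.im : ℂ) * Complex.I) p).trans (by rw [Complex.re_add_im])).symm

omit [FiniteDimensional ℚ V] in
/-- `(W, e^{0·N}F, N) = (W, F, N)`. [cite: CattaniElZeinGriffithsLe2014, §7.5 (7.5.8)] -/
theorem expTwist_zero : L.expTwist 0 = L :=
  ext_of_toMixedHodgeStructure_N' (ext_of_W_F (by rw [expTwist_W]) (funext fun p => L.expTwist_zero_F p)) rfl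

omit [FiniteDimensional ℚ V] in
/-- The underlying MHS of `(W, e^{iyN}F)` is the `Λ^{-1,-1}`-twist by `i(yN_ℂ)`. [cite: CattaniElZeinGriffithsLe2014, §7.5 (7.5.8)] -/
theorem expTwist_ofReal_mul_I_toMixedHodgeStructure (y : ℝ) :
    (L.expTwist ((y : ℂ) * Complex.I)).toMixedHodgeStructure =
      L.toMixedHodgeStructure.lambdaTwist (L.toMixedHodgeStructure.I_smul_mem_lambda
        (L.toMixedHodgeStructure.lambda.smul_mem (y : ℂ) L.N_baseChange_mem_lambda)) := by
  rw [expTwist_toMixedHodgeStructure_eq_lambdaTwist]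
  refine ext_of_W_F (by rw [lambdaTwist_W, lambdaTwist_W]) (funext fun p => ?_)
  rw [lambdaTwist_F, lambdaTwist_F, smul_smul, mul_comm Complex.I]

/-- **`δ(W, e^{iyN}F) = δ(W, F) + y N_ℂ` for real `y`** (`N_ℂ ∈ Λ^{-1,-1}` is real and commutes with `δ`,
Kato–Usui (9)); the `δ`-analogue of Kato–Usui §6.1.1 (6). [cite: KatoUsui2009, §6.1.1 (6) and §6.1.2 (9)]
[cite: CattaniKaplanSchmid1986, Prop. (2.20)] -/
theorem delta_expTwist_ofReal_mul_I (y : ℝ) :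
    (L.expTwist ((y : ℂ) * Complex.I)).toMixedHodgeStructure.delta =
      L.toMixedHodgeStructure.delta + (y : ℂ) • L.N.baseChange ℂ := by
  rw [expTwist_ofReal_mul_I_toMixedHodgeStructure]
  exact delta_lambdaTwist_I_smul (L.toMixedHodgeStructure.lambda.smul_mem (y : ℂ) L.N_baseChange_mem_lambda)
    (L.endConj_ofReal_smul_N_baseChange y) (L.commute_N_baseChange_delta.smul_left _)

/-- **`(W, e^{iyN}F, N)^ = (W, F, N)^`: the `δ`-splitting is constant along the imaginary direction of the nilpotent
orbit.** [cite: KatoUsui2009, §6.1.1 (6)] [cite: CattaniKaplanSchmid1986, Prop. (2.20)] -/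
theorem deltaSplit_expTwist_ofReal_mul_I (y : ℝ) : (L.expTwist ((y : ℂ) * Complex.I)).deltaSplit = L.deltaSplit := by
  refine ext_of_toMixedHodgeStructure_N' ?_ rfl
  rw [deltaSplit_toMixedHodgeStructure, deltaSplit_toMixedHodgeStructure, expTwist_ofReal_mul_I_toMixedHodgeStructure]
  exact deltaSplit_lambdaTwist_I_smul (L.toMixedHodgeStructure.lambda.smul_mem (y : ℂ) L.N_baseChange_mem_lambda)
    (L.endConj_ofReal_smul_N_baseChange y) (L.commute_N_baseChange_delta.smul_left _)

/-- `e^{xN_ℂ}` commutes with `δ` (`[N, δ] = 0`). [cite: KatoUsui2009, §6.1.2 (9)] -/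
theorem exp_smul_N_mul_delta (x : ℂ) :
    IsNilpotent.exp (x • L.N.baseChange ℂ) * L.toMixedHodgeStructure.delta =
      L.toMixedHodgeStructure.delta * IsNilpotent.exp (x • L.N.baseChange ℂ) :=
  Module.End.commute_exp_left_of_commute (L.isNilpotent_N_baseChange.smul x) (L.isNilpotent_N_baseChange.smul x)
    (L.commute_N_baseChange_delta.smul_left x).eq

/-- **`δ(W, e^{xN}F) = δ(W, F)` for real `x`** (`e^{xN}` is real and `Ad(e^{xN})δ = δ` as `[N, δ] = 0`); the
`δ`-analogue of Kato–Usui §6.1.1 (7) for `g = e^{xN} ∈ G_ℝ`. [cite: KatoUsui2009, §6.1.1 (7) and §6.1.2 (9)]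
[cite: CattaniKaplanSchmid1986, Prop. (2.20)] -/
theorem delta_expTwist_ofReal (x : ℝ) :
    (L.expTwist (x : ℂ)).toMixedHodgeStructure.delta = L.toMixedHodgeStructure.delta := by
  rw [expTwist_toMixedHodgeStructure_eq_lambdaTwist,
    delta_lambdaTwist_of_endConj_eq (L.smul_N_baseChange_mem_lambda _) (L.endConj_ofReal_smul_N_baseChange x),
    L.exp_smul_N_mul_delta, mul_assoc, IsNilpotent.exp_mul_exp_neg_self (L.isNilpotent_N_baseChange.smul _), mul_one]

/-- **Real coordinate changes commute with the `δ`-splitting: `(W, e^{xN}F, N)^ = (W, e^{xN}F̂, N)`** (`x` real).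
[cite: KatoUsui2009, §6.1.1 (7)] [cite: CattaniKaplanSchmid1986, Prop. (2.20)] -/
theorem deltaSplit_expTwist_ofReal (x : ℝ) : (L.expTwist (x : ℂ)).deltaSplit = L.deltaSplit.expTwist (x : ℂ) := by
  refine ext_of_toMixedHodgeStructure_N' ?_ rfl
  rw [deltaSplit_toMixedHodgeStructure, expTwist_toMixedHodgeStructure_eq_lambdaTwist,
    expTwist_toMixedHodgeStructure_eq_lambdaTwist]
  exact deltaSplit_lambdaTwist_of_endConj_eq (L.smul_N_baseChange_mem_lambda _) (L.endConj_ofReal_smul_N_baseChange x)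
    (mem_lambda_deltaSplit_of_mem_lambda (L.smul_N_baseChange_mem_lambda _))

/-- **Deligne's `δ` along the nilpotent orbit: `δ(W, e^{zN}F) = δ(W, F) + (Im z) N_ℂ`.**
[cite: KatoUsui2009, §6.1.1 (6)–(7) and §6.1.2 (9)] [cite: CattaniKaplanSchmid1986, Prop. (2.20)]
[cite: CattaniElZeinGriffithsLe2014, §7.5 (7.5.8)] -/
theorem delta_expTwist (z : ℂ) :
    (L.expTwist z).toMixedHodgeStructure.delta = L.toMixedHodgeStructure.delta + (z.im : ℂ) • L.N.baseChange ℂ := by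
  rw [expTwist_eq_expTwist_expTwist, delta_expTwist_ofReal, delta_expTwist_ofReal_mul_I]

/-- **The `δ`-splitting along the nilpotent orbit: `(W, e^{zN}F, N)^ = (W, e^{(Re z)N}F̂, N)`.**
[cite: KatoUsui2009, §6.1.1 (6)–(7)] [cite: CattaniKaplanSchmid1986, Prop. (2.20)] -/
theorem deltaSplit_expTwist (z : ℂ) : (L.expTwist z).deltaSplit = L.deltaSplit.expTwist (z.re : ℂ) := by
  rw [expTwist_eq_expTwist_expTwist, deltaSplit_expTwist_ofReal, deltaSplit_expTwist_ofReal_mul_I]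

/-- **On the imaginary axis the `δ`-splitting is constant: `(W, e^{zN}F, N)^ = (W, F, N)^` for `Re z = 0`.**
[cite: KatoUsui2009, §6.1.1 (6)] [cite: CattaniKaplanSchmid1986, Prop. (2.20)] -/
theorem deltaSplit_expTwist_of_re_eq_zero {z : ℂ} (hz : z.re = 0) : (L.expTwist z).deltaSplit = L.deltaSplit := by
  rw [deltaSplit_expTwist, hz, Complex.ofReal_zero, expTwist_zero]

/-- **`(W, e^{zN}F)` is split over `ℝ` iff `δ + (Im z) N_ℂ = 0`.** [cite: KatoUsui2009, §6.1.2 (10)]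
[cite: CattaniKaplanSchmid1986, Prop. (2.20)] -/
theorem isSplitOverR_expTwist_iff (z : ℂ) :
    (L.expTwist z).toMixedHodgeStructure.IsSplitOverR ↔
      L.toMixedHodgeStructure.delta + (z.im : ℂ) • L.N.baseChange ℂ = 0 := by
  rw [← delta_eq_zero_iff, delta_expTwist]

omit [FiniteDimensional ℚ V] in
/-- `ℂ ⊗_ℚ (-)` reflects zero maps: `N ≠ 0 → N_ℂ ≠ 0` (`ℚ → ℂ` is faithfully flat). [folklore] -/
private theorem N_baseChange_ne_zero (hN : L.N ≠ 0) : L.N.baseChange ℂ ≠ 0 := by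
  intro h
  apply hN
  have hf := Module.Flat.rTensor_preserves_injective_linearMap (M := V) (Algebra.linearMap ℚ ℂ)
    (algebraMap ℚ ℂ).injective
  have hinj : Function.Injective fun v : V => (1 : ℂ) ⊗ₜ[ℚ] v := by
    intro v w hvw
    have : (Algebra.linearMap ℚ ℂ).rTensor V ((TensorProduct.lid ℚ V).symm v) =
        (Algebra.linearMap ℚ ℂ).rTensor V ((TensorProduct.lid ℚ V).symm w) := by
      simpa using hvw
    exact (TensorProduct.lid ℚ V).symm.injective (hf this)
  refine LinearMap.ext fun v => hinj ?_
  show (1 : ℂ) ⊗ₜ[ℚ] L.N v = (1 : ℂ) ⊗ₜ[ℚ] ((0 : V →ₗ[ℚ] V) v)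
  rw [LinearMap.zero_apply, TensorProduct.tmul_zero, ← LinearMap.baseChange_tmul, h, LinearMap.zero_apply]

/-- **For an `ℝ`-split `(W, F, N)` with `N ≠ 0`, the point `e^{zN}F` of the nilpotent orbit is `ℝ`-split iff `z` is
real.** [cite: KatoUsui2009, §6.1.2 (10)] [cite: CattaniKaplanSchmid1986, Prop. (2.20)] -/
theorem isSplitOverR_expTwist_iff_im_eq_zero (h : L.toMixedHodgeStructure.IsSplitOverR) (hN : L.N ≠ 0) (z : ℂ) :
    (L.expTwist z).toMixedHodgeStructure.IsSplitOverR ↔ z.im = 0 := by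
  rw [isSplitOverR_expTwist_iff, h.delta_eq_zero, zero_add, smul_eq_zero, Complex.ofReal_eq_zero,
    or_iff_left (L.N_baseChange_ne_zero hN)]

end LimitMixedHodgeStructure

end Literature.AlgebraicGeometry.HodgeTheory

end
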